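import Literature.NumberTheory.Automorphic.LocalOrbitalIntegrand
import Mathlib.Topology.Algebra.Group.OpenMapping
import Mathlib.Topology.Baire.LocallyCompactRegular
import HarnessLib

/-!
# A CLOSED conjugacy class has a closed-embedding orbit map `G ⧸ C(γ) → G` (σ-compact locally compact groups):
# the open-mapping theorem for the conjugation action, and the compact support ∕ integrability of orbital integrands
(Deitmar–Echterhoff, *Principles of Harmonic Analysis* (2014), Lemma 9.3.3; Bourbaki, *Intégration* VII §1 App. I Lemme 2;
Rogawski 1990 §4.9)

Topic `MeasureTheory/Group`; namespace `Literature.MeasureTheory.Group` (generic part, next to the tree's orbital integrand ★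
`descConj` and ★ `LocalOrbitalIntegrand`); the dress for ★ `orbitalIntegral` ∕ the local unitary groups
`U(H)(L⁺_v) = (cmDatum L N H).Local v` in `Literature.NumberTheory.Automorphic`.  THEOREMS ONLY (no definition, no instance,
no named fact, no `sorry`).

★ `LocalOrbitalIntegrand` (F0P3a-p02 (g0)) proves: IF the orbit map `y C(γ) ↦ y γ y⁻¹ : G ⧸ C(γ) → G` is a CLOSED EMBEDDING,
then the orbital integrand of every `f ∈ C_c(G)` has compact support and is integrable against every measure on `G ⧸ C(γ)`
finite on compacta — and leaves the closed-embedding property as a hypothesis («for semisimple `γ` … the closedness of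
semisimple orbits, NOT proved here»).  This file reduces that hypothesis to the CLOSEDNESS OF THE CONJUGACY CLASS alone:

* §1 `isOpenMap_conj_codRestrict_of_isClosed` — in a σ-compact, locally compact, Hausdorff group `G`, if the conjugacy class
  `𝒪(γ) = {y γ y⁻¹}` is closed then the orbit map `G → 𝒪(γ)`, `y ↦ y γ y⁻¹`, is OPEN onto the class (Mathlib's Baire-category
  open-mapping theorem `isOpenMap_smul_of_sigmaCompact` for the transitive conjugation action of `G` on the locally compact,
  hence Baire, space `𝒪(γ)`); hence **`isClosedEmbedding_descConj_id_of_isClosed`** — the orbit map `G ⧸ C(γ) → G` is a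
  closed embedding (a continuous open bijection `G ⧸ C(γ) → 𝒪(γ)` is a homeomorphism, composed with the closed inclusion
  `𝒪(γ) ⊆ G`), and conversely `isClosed_conjClass_of_isClosedEmbedding` (the range of a closed embedding is closed):
  **`isClosedEmbedding_descConj_id_iff_isClosed`**;
* §2 consequences over ★ `LocalOrbitalIntegrand`: `hasCompactSupport_descConj_of_isClosed`, `integrable_descConj_of_isClosed`,
  `orbitalIntegral_add_of_isClosed`, and the `U(H)(L⁺_v)` dress `UnitaryGroup.integrable_descConj_local_of_isClosed`,
  `UnitaryGroup.localOrbitalIntegral_add_of_isClosed` [Rogawski1990 §4.9 p. 54: orbital integrals `Φ(γ, f)` at (regular)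
  semisimple `γ` converge — closed orbits; the closedness of REGULAR SEMISIMPLE classes of `U(H)(L⁺_v)` is the sequel
  `LocalRegularOrbitClosed`].

## References
* A. Deitmar, S. Echterhoff, *Principles of Harmonic Analysis*, 2nd ed. (2014), Lemma 9.3.3 [DeitmarEchterhoff2014].
* J. Rogawski, *Automorphic Representations of Unitary Groups in Three Variables* (1990), §4.9 p. 54 [Rogawski1990].
-/

noncomputable section

open MeasureTheory Measure Topology Set NumberField IsDedekindDomain

namespace Literature.MeasureTheory.Group

/-! ## §1 Closed conjugacy class ⇒ open orbit map onto the class ⇒ closed-embedding orbit map on `G ⧸ C(γ)` -/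

section OrbitMap

variable {G : Type*} [Group G] [TopologicalSpace G] [IsTopologicalGroup G] (γ₀ : G)

/-- **Open orbit map onto a closed conjugacy class.**  In a σ-compact, locally compact, Hausdorff topological group, if the
conjugacy class `𝒪(γ₀) = {y γ₀ y⁻¹}` is closed, then `y ↦ y γ₀ y⁻¹`, viewed as a map `G → 𝒪(γ₀)`, is an OPEN map: the
conjugation action of `G` on `𝒪(γ₀)` is continuous and transitive, `𝒪(γ₀)` is locally compact Hausdorff (closed in `G`),
hence a Baire space, and Mathlib's open-mapping theorem `isOpenMap_smul_of_sigmaCompact` applies.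
[cite: DeitmarEchterhoff2014, Lemma 9.3.3] -/
theorem isOpenMap_conj_codRestrict_of_isClosed [SigmaCompactSpace G] [LocallyCompactSpace G] [T2Space G]
    (hO : IsClosed (Set.range fun y : G => y * γ₀ * y⁻¹)) :
    IsOpenMap (Set.rangeFactorization fun y : G => y * γ₀ * y⁻¹) := by
  set O : Set G := Set.range fun y : G => y * γ₀ * y⁻¹ with hOdef
  have hmem : ∀ (g : G) (x : O), g * (x : G) * g⁻¹ ∈ O := by
    rintro g ⟨_, y, rfl⟩
    exact ⟨g * y, by simp only [mul_inv_rev, mul_assoc]⟩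
  letI : MulAction G O :=
    { smul := fun g x => ⟨g * (x : G) * g⁻¹, hmem g x⟩
      one_smul := fun x => Subtype.ext (by
        change (1 : G) * (x : G) * (1 : G)⁻¹ = x
        simp)
      mul_smul := fun g h x => Subtype.ext (by
        change g * h * (x : G) * (g * h)⁻¹ = g * (h * (x : G) * h⁻¹) * g⁻¹
        simp only [mul_inv_rev, mul_assoc]) }
  have hsmul : ∀ (g : G) (x : O), ((g • x : O) : G) = g * (x : G) * g⁻¹ := fun _ _ => rfl
  haveI : ContinuousSMul G O :=
    ⟨(((continuous_fst.mul (continuous_subtype_val.comp continuous_snd)).mul continuous_fst.inv).subtype_mk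
        fun p : G × O => hmem p.1 p.2).congr fun _ => rfl⟩
  haveI : MulAction.IsPretransitive G O :=
    ⟨by
      rintro ⟨_, a, rfl⟩ ⟨_, b, rfl⟩
      refine ⟨b * a⁻¹, Subtype.ext ?_⟩
      rw [hsmul]
      simp only [mul_inv_rev, inv_inv, mul_assoc, inv_mul_cancel_left]⟩
  haveI : LocallyCompactSpace O := hO.isClosedEmbedding_subtypeVal.locallyCompactSpace
  have x₀mem : γ₀ ∈ O := ⟨1, by simp⟩
  have hfun : (Set.rangeFactorization fun y : G => y * γ₀ * y⁻¹) = fun g : G => g • (⟨γ₀, x₀mem⟩ : O) := by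
    funext g
    exact Subtype.ext rfl
  rw [hfun]
  exact isOpenMap_smul_of_sigmaCompact (G := G) (X := O) ⟨γ₀, x₀mem⟩

/-- **A closed conjugacy class has a closed-embedding orbit map.**  In a σ-compact, locally compact, Hausdorff group, if
`𝒪(γ₀) = {y γ₀ y⁻¹}` is closed then the orbit map `G ⧸ C(γ₀) → G`, `y C(γ₀) ↦ y γ₀ y⁻¹` (★ `descConj γ₀ C(γ₀) _ id`) is a
CLOSED EMBEDDING: it is a continuous bijection onto `𝒪(γ₀)` (★ `injective_descConj_id_centralizer`, ★ `range_descConj_id`),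
open onto `𝒪(γ₀)` by `isOpenMap_conj_codRestrict_of_isClosed` (the quotient map `G → G ⧸ C(γ₀)` is surjective), hence a
homeomorphism `G ⧸ C(γ₀) ≃ₜ 𝒪(γ₀)` followed by the closed inclusion `𝒪(γ₀) ⊆ G`.  This is the hypothesis `he` of ★
`hasCompactSupport_descConj` ∕ ★ `integrable_descConj`. [cite: DeitmarEchterhoff2014, Lemma 9.3.3] -/
theorem isClosedEmbedding_descConj_id_of_isClosed [SigmaCompactSpace G] [LocallyCompactSpace G] [T2Space G]
    (hO : IsClosed {g | ∃ y : G, y * γ₀ * y⁻¹ = g}) :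
    IsClosedEmbedding (descConj γ₀ (Subgroup.centralizer ({γ₀} : Set G))
      (fun _ hg => Subgroup.mem_centralizer_singleton_iff.1 hg) id) := by
  set φ := descConj γ₀ (Subgroup.centralizer ({γ₀} : Set G))
    (fun _ hg => Subgroup.mem_centralizer_singleton_iff.1 hg) id with hφ
  have hO' : IsClosed (Set.range fun y : G => y * γ₀ * y⁻¹) := hO
  have hrange : Set.range φ = Set.range fun y : G => y * γ₀ * y⁻¹ := range_descConj_id γ₀ _ _
  have hmemO : ∀ q, φ q ∈ Set.range fun y : G => y * γ₀ * y⁻¹ := fun q => hrange ▸ Set.mem_range_self q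
  set ψ : G ⧸ Subgroup.centralizer ({γ₀} : Set G) → Set.range (fun y : G => y * γ₀ * y⁻¹) :=
    fun q => ⟨φ q, hmemO q⟩ with hψ
  have hψc : Continuous ψ := (continuous_descConj_id γ₀ _ _).subtype_mk hmemO
  have hψi : Function.Injective ψ := fun a b hab =>
    injective_descConj_id_centralizer γ₀ (congrArg Subtype.val hab)
  have hψs : Function.Surjective ψ := by
    rintro ⟨_, y, rfl⟩
    exact ⟨QuotientGroup.mk y, Subtype.ext rfl⟩
  have hψmk : ψ ∘ QuotientGroup.mk = Set.rangeFactorization fun y : G => y * γ₀ * y⁻¹ := by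
    funext y
    exact Subtype.ext rfl
  have hψo : IsOpenMap ψ := by
    intro U hU
    have himage : ψ '' U = (Set.rangeFactorization fun y : G => y * γ₀ * y⁻¹) ''
        ((QuotientGroup.mk : G → G ⧸ Subgroup.centralizer ({γ₀} : Set G)) ⁻¹' U) := by
      rw [← hψmk, Set.image_comp, Set.image_preimage_eq U QuotientGroup.mk_surjective]
    rw [himage]
    exact isOpenMap_conj_codRestrict_of_isClosed γ₀ hO' _ (hU.preimage QuotientGroup.continuous_mk)
  let e : G ⧸ Subgroup.centralizer ({γ₀} : Set G) ≃ₜ Set.range (fun y : G => y * γ₀ * y⁻¹) :=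
    (Equiv.ofBijective ψ ⟨hψi, hψs⟩).toHomeomorphOfContinuousOpen hψc hψo
  have hcomp : φ = Subtype.val ∘ e := rfl
  rw [hcomp]
  exact hO'.isClosedEmbedding_subtypeVal.comp e.isClosedEmbedding

omit [IsTopologicalGroup G] in
/-- Conversely, a closed-embedding orbit map has a closed conjugacy class (its range, ★ `range_descConj_id`).
[cite: DeitmarEchterhoff2014, Lemma 9.3.3] -/
theorem isClosed_conjClass_of_isClosedEmbedding
    (he : IsClosedEmbedding (descConj γ₀ (Subgroup.centralizer ({γ₀} : Set G))
      (fun _ hg => Subgroup.mem_centralizer_singleton_iff.1 hg) id)) :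
    IsClosed {g | ∃ y : G, y * γ₀ * y⁻¹ = g} := by
  rw [← range_descConj_id γ₀ (Subgroup.centralizer ({γ₀} : Set G)) (fun _ hg => Subgroup.mem_centralizer_singleton_iff.1 hg)]
  exact he.isClosed_range

/-- **Closed embedding ⟺ closed class** (σ-compact locally compact Hausdorff groups): the orbit map `G ⧸ C(γ₀) → G` is a closed
embedding iff the conjugacy class of `γ₀` is closed. [cite: DeitmarEchterhoff2014, Lemma 9.3.3] -/
theorem isClosedEmbedding_descConj_id_iff_isClosed [SigmaCompactSpace G] [LocallyCompactSpace G] [T2Space G] :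
    IsClosedEmbedding (descConj γ₀ (Subgroup.centralizer ({γ₀} : Set G))
      (fun _ hg => Subgroup.mem_centralizer_singleton_iff.1 hg) id) ↔ IsClosed {g | ∃ y : G, y * γ₀ * y⁻¹ = g} :=
  ⟨isClosed_conjClass_of_isClosedEmbedding γ₀, isClosedEmbedding_descConj_id_of_isClosed γ₀⟩

/-- The orbit map of an element with closed class is PROPER (a closed embedding is a proper map). [cite: DeitmarEchterhoff2014, Lemma 9.3.3] -/
theorem isProperMap_descConj_id_of_isClosed [SigmaCompactSpace G] [LocallyCompactSpace G] [T2Space G]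
    (hO : IsClosed {g | ∃ y : G, y * γ₀ * y⁻¹ = g}) :
    IsProperMap (descConj γ₀ (Subgroup.centralizer ({γ₀} : Set G))
      (fun _ hg => Subgroup.mem_centralizer_singleton_iff.1 hg) id) :=
  (isClosedEmbedding_descConj_id_of_isClosed γ₀ hO).isProperMap

/-- With a closed class, `{y C(γ₀) ∣ y γ₀ y⁻¹ ∈ K}` is compact for every compact `K ⊆ G` — the finiteness mechanism behind orbital
integrals of compactly supported functions. [cite: DeitmarEchterhoff2014, Lemma 9.3.3] -/
theorem isCompact_preimage_descConj_id_of_isClosed [SigmaCompactSpace G] [LocallyCompactSpace G] [T2Space G]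
    (hO : IsClosed {g | ∃ y : G, y * γ₀ * y⁻¹ = g}) {K : Set G} (hK : IsCompact K) :
    IsCompact (descConj γ₀ (Subgroup.centralizer ({γ₀} : Set G))
      (fun _ hg => Subgroup.mem_centralizer_singleton_iff.1 hg) id ⁻¹' K) :=
  (isClosedEmbedding_descConj_id_of_isClosed γ₀ hO).isCompact_preimage hK

/-! ## §2 Compact support and integrability of orbital integrands at a closed class -/

/-- At a closed conjugacy class the orbital integrand `y C(γ₀) ↦ f(y γ₀ y⁻¹)` of a compactly supported `f` has compact support
(★ `hasCompactSupport_descConj`). [cite: DeitmarEchterhoff2014, Lemma 9.3.3] -/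
theorem hasCompactSupport_descConj_of_isClosed [SigmaCompactSpace G] [LocallyCompactSpace G] [T2Space G]
    (hO : IsClosed {g | ∃ y : G, y * γ₀ * y⁻¹ = g}) {α : Type*} [TopologicalSpace α] [Zero α] {f : G → α}
    (hf : HasCompactSupport f) :
    HasCompactSupport (descConj γ₀ (Subgroup.centralizer ({γ₀} : Set G))
      (fun _ hg => Subgroup.mem_centralizer_singleton_iff.1 hg) f) :=
  hasCompactSupport_descConj γ₀ _ _ hf (isClosedEmbedding_descConj_id_of_isClosed γ₀ hO)

/-- **Orbital integrands at a closed class are integrable**: for `f ∈ C_c(G, E)` and every measure on `G ⧸ C(γ₀)` finite on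
compacta (★ `integrable_descConj`). [cite: DeitmarEchterhoff2014, Lemma 9.3.3] -/
theorem integrable_descConj_of_isClosed [SigmaCompactSpace G] [LocallyCompactSpace G] [T2Space G]
    (hO : IsClosed {g | ∃ y : G, y * γ₀ * y⁻¹ = g}) {E : Type*} [NormedAddCommGroup E]
    [MeasurableSpace (G ⧸ Subgroup.centralizer ({γ₀} : Set G))] [BorelSpace (G ⧸ Subgroup.centralizer ({γ₀} : Set G))]
    {f : G → E} (hfc : Continuous f) (hf : HasCompactSupport f)
    (m : Measure (G ⧸ Subgroup.centralizer ({γ₀} : Set G))) [IsFiniteMeasureOnCompacts m] :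
    Integrable (descConj γ₀ (Subgroup.centralizer ({γ₀} : Set G))
      (fun _ hg => Subgroup.mem_centralizer_singleton_iff.1 hg) f) m :=
  integrable_descConj γ₀ _ _ hfc hf (isClosedEmbedding_descConj_id_of_isClosed γ₀ hO) m

end OrbitMap

end Literature.MeasureTheory.Group

namespace Literature.NumberTheory.Automorphic

open Literature.MeasureTheory.Group

/-! ### The dress for ★ `orbitalIntegral` and for the local unitary groups `U(H)(L⁺_v)` -/

section Orbital

variable {G : Type*} [Group G] [TopologicalSpace G] [IsTopologicalGroup G]
  [SigmaCompactSpace G] [LocallyCompactSpace G] [T2Space G]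
  {E : Type*} [NormedAddCommGroup E] [NormedSpace ℝ E]
  (γ : G) [MeasurableSpace (G ⧸ Subgroup.centralizer ({γ} : Set G))] [BorelSpace (G ⧸ Subgroup.centralizer ({γ} : Set G))]
  (m : Measure (G ⧸ Subgroup.centralizer ({γ} : Set G))) [IsFiniteMeasureOnCompacts m]

/-- **Additivity of the orbital integral on `C_c(G)` at a closed class**, no integrability hypothesis (★
`orbitalIntegral_add_of_isClosedEmbedding`). [cite: Rogawski1990, §4.9 p. 54] -/
theorem orbitalIntegral_add_of_isClosed (hO : IsClosed {g | ∃ y : G, y * γ * y⁻¹ = g})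
    {f g : G → E} (hfc : Continuous f) (hf : HasCompactSupport f) (hgc : Continuous g) (hg : HasCompactSupport g) :
    orbitalIntegral γ (f + g) m = orbitalIntegral γ f m + orbitalIntegral γ g m :=
  orbitalIntegral_add_of_isClosedEmbedding γ m (isClosedEmbedding_descConj_id_of_isClosed γ hO) hfc hf hgc hg

end Orbital

namespace UnitaryGroup

section CM

variable (L : Type) [Field L] [NumberField L] [IsCMField L] (N : ℕ) (H : Matrix (Fin N) (Fin N) L)
  (v : HeightOneSpectrum (𝓞 ↥(NumberField.maximalRealSubfield L))) (γ : (cmDatum L N H).Local v)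

/-- **On `U(H)(L⁺_v)` a closed conjugacy class has a closed-embedding orbit map** (`U(H)(L⁺_v)` is locally compact, second
countable — ★ `LocalUnitaryGroupCongrMeasure` §1 — hence σ-compact, and Hausdorff). [cite: Rogawski1990, §4.9 p. 54] -/
theorem isClosedEmbedding_descConj_local_of_isClosed
    (hO : IsClosed {g | ∃ y : (cmDatum L N H).Local v, y * γ * y⁻¹ = g}) :
    IsClosedEmbedding (descConj γ (Subgroup.centralizer ({γ} : Set ((cmDatum L N H).Local v)))
      (fun _ hg => Subgroup.mem_centralizer_singleton_iff.1 hg) id) :=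
  isClosedEmbedding_descConj_id_of_isClosed γ hO

/-- For every compact `K ⊆ U(H)(L⁺_v)` and `γ` with closed class, `{y G_γ ∣ y γ y⁻¹ ∈ K}` is compact in `U(H)(L⁺_v) ⧸ G_γ`.
[cite: Rogawski1990, §4.9 p. 54] -/
theorem isCompact_preimage_descConj_local_of_isClosed
    (hO : IsClosed {g | ∃ y : (cmDatum L N H).Local v, y * γ * y⁻¹ = g}) {K : Set ((cmDatum L N H).Local v)}
    (hK : IsCompact K) :
    IsCompact (descConj γ (Subgroup.centralizer ({γ} : Set ((cmDatum L N H).Local v)))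
      (fun _ hg => Subgroup.mem_centralizer_singleton_iff.1 hg) id ⁻¹' K) :=
  isCompact_preimage_descConj_id_of_isClosed γ hO hK

variable [MeasurableSpace ((cmDatum L N H).Local v ⧸ Subgroup.centralizer ({γ} : Set ((cmDatum L N H).Local v)))]
  [BorelSpace ((cmDatum L N H).Local v ⧸ Subgroup.centralizer ({γ} : Set ((cmDatum L N H).Local v)))]
  (m : Measure ((cmDatum L N H).Local v ⧸ Subgroup.centralizer ({γ} : Set ((cmDatum L N H).Local v))))
  [IsFiniteMeasureOnCompacts m]

/-- **Local orbital integrands at a closed class are integrable**: for `f_v ∈ C_c(U(H)(L⁺_v))` and every measure on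
`U(H)(L⁺_v) ⧸ G_γ` finite on compacta (★ `integrable_descConj_local` with `he` discharged). [cite: Rogawski1990, §4.9 p. 54] -/
theorem integrable_descConj_local_of_isClosed
    (hO : IsClosed {g | ∃ y : (cmDatum L N H).Local v, y * γ * y⁻¹ = g})
    {f : (cmDatum L N H).Local v → ℂ} (hfc : Continuous f) (hf : HasCompactSupport f) :
    Integrable (descConj γ (Subgroup.centralizer ({γ} : Set ((cmDatum L N H).Local v)))
      (fun _ hg => Subgroup.mem_centralizer_singleton_iff.1 hg) f) m :=
  integrable_descConj_local L N H v γ m (isClosedEmbedding_descConj_id_of_isClosed γ hO) hfc hf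

/-- `Φ(γ, f + g) = Φ(γ, f) + Φ(γ, g)` on `C_c(U(H)(L⁺_v))` at a closed class (★ `localOrbitalIntegral_add_of_isClosedEmbedding`).
[cite: Rogawski1990, §4.9 p. 54] -/
theorem localOrbitalIntegral_add_of_isClosed
    (hO : IsClosed {g | ∃ y : (cmDatum L N H).Local v, y * γ * y⁻¹ = g})
    {f g : (cmDatum L N H).Local v → ℂ} (hfc : Continuous f) (hf : HasCompactSupport f) (hgc : Continuous g)
    (hg : HasCompactSupport g) :
    localOrbitalIntegral L N H v γ (f + g) m = localOrbitalIntegral L N H v γ f m + localOrbitalIntegral L N H v γ g m :=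
  localOrbitalIntegral_add_of_isClosedEmbedding L N H v γ m (isClosedEmbedding_descConj_id_of_isClosed γ hO) hfc hf hgc hg

end CM

end UnitaryGroup

end Literature.NumberTheory.Automorphic

end
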